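import Literature.Barriers.AnomalousDissipation.ConvexIntegrationNonLerayStart
import Literature.Analysis.FluidPDE.ForcedNavierStokesReynolds
import Literature.Analysis.FluidPDE.TorusClassicalLerayHopfProofs
import HarnessLib

/-!
# Barrier (AnomalousDissipation), companion of `ConvexIntegrationNonLeray`: Leray–Hopf (indeed
  classical) vanishing-viscosity realisation of EVERY Hölder Euler flow is FREE once the force may
  depend on `ν` and is measured below `L²` — the open problem lives in the force topology

D-0021 barrier audit (2026-08-17, generation 9) of
`Literature/Barriers/AnomalousDissipation/ConvexIntegrationNonLeray` and its proof file `…Proofs`.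
The parent block bars the transfer of convex-integration Euler flows into a witness of
`Literature.Turb.ZerothLaw` because their vanishing-viscosity REALISATION "by Leray–Hopf or classical
Navier–Stokes solutions" is a documented open problem (Buckmaster–Vicol 2019, §1.2; Bruè–De Lellis
2023, §2), the printed reach being realisation by WEAK (Oseen) solutions of the UNFORCED equations
(Buckmaster–Vicol 2019, Thm. 1.3 = tree theorem `BuckmasterVicol2019_thm13_holds`). Its scope
caveats (c), (h) record in words that the start of that very scheme — the space–time mollification
`u_ℓ` of the Euler flow, §2.5 (2.12)–(2.15) — is an exact smooth solution of Navier–Stokes driven by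
a force `div R` that is small in negative norms ("the force can be made arbitrarily small in
`L^∞_t W^{-1,1}`", Cheskidov–Luo 2021, §1) while its work does not vanish (Buckmaster–Vicol 2020,
Rem. 6.4). This file turns that remark into theorems of the tree, from three accepted theorems:

* `BuckmasterVicol2019_mollifiedEulerStart_holds` (`ConvexIntegrationNonLerayStart`; BV19 §2.5
  (2.12)–(2.15)): for every zero-mean weak Euler flow `u ∈ C^{β̄}_{t,x}`, `λ ≥ Λ₀(η)` and
  `0 < ν ≤ λ^{-1}`, a classical Navier–Stokes–Reynolds triple `(v, p, R)` at viscosity `ν` with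
  `‖R‖_{C⁰} ≤ C λ^{-β̄}` and `sup_t ‖v(t) - u(t)‖_{H^{β'}} ≤ η`;
* `Torus.IsForcedNSReynoldsOn.isClassicalNSSolutionOn_add` (`FluidPDE/ForcedNavierStokesReynolds`;
  BV20 Rem. 6.4 "the Navier–Stokes equations with a `C^∞` smooth forcing term `f^ν = div F^ν`"):
  a Navier–Stokes–Reynolds triple IS a classical solution of Navier–Stokes forced by `div R`;
* `Torus.IsClassicalNSSolutionOn.isLerayHopfOn_of_convex` (`FluidPDE/TorusClassicalLerayHopfProofs`;
  Robinson–Rodrigo–Sadowski 2016, Thm. 6.5): classical forced solutions on `[0,T] × T³` are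
  Leray–Hopf weak solutions on `[0,T)` (energy EQUALITY, `L²_t H¹_x`, for their own force).

Results (all on the flat unit torus `T³`, hypotheses of `u` exactly those of
`BuckmasterVicol2019_thm13`):

* `holderEuler_lerayHopf_realisation_smallForce` — quantitative form: for `0 < β' < (β̄ ∧ 1)/2`
  there is `C ≥ 1` such that for every `η > 0` there is `ν₀ > 0` such that for EVERY viscosity
  `0 < ν ≤ ν₀` some classical solution `(v, p)` of Navier–Stokes with viscosity `ν` on `[0,T] × T³`,
  driven by the smooth force `f = div R` with `sup |R| ≤ η`, is a Leray–Hopf solution on `[0,T)`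
  for that force, has zero mean, `sup_t ‖v(t)‖_{H^{β'}} ≤ C`, `sup_t ‖v(t) - u(t)‖_{H^{β'}} ≤ η`
  and `sup_t ‖v(t) - u(t)‖_{L²} ≤ η`;
* `holderEuler_lerayHopf_realisation_eventually` — the same, "for all sufficiently small `ν > 0`"
  (`∀ᶠ ν in 𝓝[>] 0`), and `…_eventually_seq` along ANY prescribed viscosities `ν_n → 0`;
* `BuckmasterVicol2019_thm13_lerayHopf_smallForce` — the shape of Thm. 1.3 itself in the
  Leray–Hopf class modulo vanishing forces: `β > 0`, `ν_n → 0` and CLASSICAL solutions `v_n` of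
  Navier–Stokes with viscosity `ν_n` and smooth forces `f_n = div R_n`, `sup |R_n| ≤ 1/(n+1)` (so
  `f_n → 0` in `C⁰_t W^{-1,∞}`, a fortiori in `L²_t H^{-1}`), each a Leray–Hopf solution on `[0,T)`
  for its force, zero-mean, uniformly bounded in `C⁰_t H^β_x`, with `v_n → u` in `C⁰_t L²_x`.

What this says for the barrier. The clause "vanishing-viscosity realisation of convex-integration
Euler solutions by Leray–Hopf or classical Navier–Stokes solutions … open" of the parent's
`blocks:` line is a statement about the FORCE, not about the solution class: with `ν`-dependent
forces vanishing in `C⁰_t W^{-1,∞}` the Leray–Hopf (indeed classical) realisation of EVERY Hölder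
weak Euler flow — dissipative, conservative or energy-gaining, unique or not — is free, at every
sufficiently small viscosity and not only along a sequence. The companions' energy constraints
(`ConvexIntegrationNonLerayEnergyCeilingNarrow`, `…DissipationBudgetNarrow`, `…ResolutionNarrow`)
are not violated: they are paid by the work `∫₀ᵀ (f_n, v_n)`, which need not vanish although
`f_n → 0` in `W^{-1,∞}` (Buckmaster–Vicol 2020, Rem. 6.4, where it even diverges; the "anomalous
work" of Cheskidov–Luo 2021). On the other side, when the forces converge in `L¹(0,T; L²)` the
works pass to the limit along `C⁰_t L²`-convergent families (Cheskidov–Peng 2025, §1 (1.7)), so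
the three energy companions apply verbatim with the limiting work, and classical families converge
to the classical Euler solution whenever one exists (barrier fact `BrueDeLellis2023_lemma7_convergence`,
file `ClassicalEulerLimit`). Hence realisation statements carry information exactly from
`L¹_t L²_x`-control of `f_n - f` upwards — in particular for the SAME steady `f` (route EulerLimit,
crux `VanishingViscosityRealizationV2`; the summit itself) — and none at `W^{-1,∞}` strength (this
file). This is the force-side twin of generation 5's `weakNS_realisation_LpLinfty` (realisation by
weak solutions is vacuous below `L²` strength of the CONVERGENCE).

No named facts are introduced (theorems only; D-0026).

## References

* T. Buckmaster, V. Vicol, Ann. of Math. 189 (2019) = arXiv:1709.10033: Thm. 1.3, §2.5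
  (2.12)–(2.15). [`BuckmasterVicol2019Annals`]
* T. Buckmaster, V. Vicol, EMS Surv. Math. Sci. 6 (2020) = arXiv:1901.09023: Rem. 6.4.
  [`BuckmasterVicol2020`]
* A. Cheskidov, X. Luo, *Anomalous dissipation, anomalous work, and energy balance for the
  Navier–Stokes equations*, SIAM J. Math. Anal. 53 (2021), 3856–3887, §1. [`CheskidovLuo2021`]
* A. Cheskidov, Q. Peng, *Anomalous dissipation at Onsager-critical regularity*, arXiv:2512.24568,
  §1 (1.7). [`CheskidovPeng2025`]
* E. Bruè, C. De Lellis, Comm. Math. Phys. 400 (2023), Appendix (Lemma 7). [`BrueDeLellis2023`]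
* J. C. Robinson, J. L. Rodrigo, W. Sadowski, *The Three-Dimensional Navier–Stokes Equations*, CUP
  2016, Thm. 6.5. [`RobinsonRodrigoSadowski2016`]
-/

noncomputable section

open MeasureTheory Set Filter Topology
open scoped ENNReal NNReal

namespace Literature.Barriers.AnomalousDissipation

open Literature.Analysis.FunctionSpaces Literature.Analysis.FluidPDE

/-! ## A Navier–Stokes–Reynolds triple is a classical (hence Leray–Hopf) forced solution -/

/-- A classical solution `(v, p, R)` of the Navier–Stokes–Reynolds system with viscosity `ν` on a
time set `S` is a classical solution of the Navier–Stokes system forced by `f = div R`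
(Buckmaster–Vicol 2020, Rem. 6.4: "the Navier–Stokes equations with a `C^∞` smooth forcing term
`f^ν = div F^ν`"; the tree's `Torus.IsForcedNSReynoldsOn.isClassicalNSSolutionOn_add` with zero
body force). [cite: BuckmasterVicol2020, Rem. 6.4] -/
theorem isClassicalNSSolutionOn_stressForce {S : Set ℝ} {ν : ℝ}
    {v : ℝ → UnitAddTorus (Fin 3) → EuclideanSpace ℝ (Fin 3)} {p : ℝ → UnitAddTorus (Fin 3) → ℝ}
    {R : ℝ → UnitAddTorus (Fin 3) → Fin 3 → EuclideanSpace ℝ (Fin 3)}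
    (h : Torus.IsNSReynoldsOn S ν v p R) :
    Torus.IsClassicalNSSolutionOn S ν (fun t x => Torus.tensorDivergence (R t) x) v p := by
  have h1 := h.isForcedNSReynoldsOn.isClassicalNSSolutionOn_add
  have h2 : (fun t x => (0 : ℝ → UnitAddTorus (Fin 3) → EuclideanSpace ℝ (Fin 3)) t x +
        Torus.tensorDivergence (R t) x) = fun t x => Torus.tensorDivergence (R t) x := by
    funext t x
    simp
  rw [h2] at h1
  exact h1

/-- On `[0,T]`, `T > 0`, a classical Navier–Stokes–Reynolds triple is a Leray–Hopf weak solution on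
`[0,T)` of Navier–Stokes forced by `div R`, with datum `v 0` (energy equality for classical
solutions, Robinson–Rodrigo–Sadowski 2016, Thm. 6.5, through the tree's
`Torus.IsClassicalNSSolutionOn.isLerayHopfOn_of_convex`). [cite: RobinsonRodrigoSadowski2016, Thm. 6.5] -/
theorem isLerayHopfOn_stressForce {T ν : ℝ} (hT : 0 < T)
    {v : ℝ → UnitAddTorus (Fin 3) → EuclideanSpace ℝ (Fin 3)} {p : ℝ → UnitAddTorus (Fin 3) → ℝ}
    {R : ℝ → UnitAddTorus (Fin 3) → Fin 3 → EuclideanSpace ℝ (Fin 3)}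
    (h : Torus.IsNSReynoldsOn (Icc 0 T) ν v p R) :
    Torus.IsLerayHopfOn T ν (fun t x => Torus.tensorDivergence (R t) x) (v 0) v :=
  (isClassicalNSSolutionOn_stressForce h).isLerayHopfOn_of_convex (convex_Icc 0 T) hT Subset.rfl

/-! ## Parameter bookkeeping: `C λ^{-β̄} ≤ η` for `λ ≥ (C/η)^{1/β̄}` -/

/-- For `λ ≥ (C/η)^{1/b}` (`b, η > 0`, `C ≥ 0`, `λ > 0`) one has `C λ^{-b} ≤ η`. [folklore] -/
theorem mul_rpow_neg_le_of_le {C η b lam : ℝ} (hC : 0 ≤ C) (hη : 0 < η) (hb : 0 < b)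
    (hlam0 : 0 < lam) (hlam : (C / η) ^ (1 / b) ≤ lam) : C * lam ^ (-b) ≤ η := by
  have hCη : 0 ≤ C / η := div_nonneg hC hη.le
  have h1 : C / η ≤ lam ^ b := by
    calc C / η = ((C / η) ^ (1 / b)) ^ b := by
          rw [← Real.rpow_mul hCη, one_div_mul_cancel hb.ne', Real.rpow_one]
      _ ≤ lam ^ b := Real.rpow_le_rpow (Real.rpow_nonneg hCη _) hlam hb.le
  have hpos : 0 < lam ^ b := Real.rpow_pos_of_pos hlam0 _
  rw [Real.rpow_neg hlam0.le, ← div_eq_mul_inv, div_le_iff₀ hpos]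
  calc C = C / η * η := by field_simp
    _ ≤ lam ^ b * η := mul_le_mul_of_nonneg_right h1 hη.le
    _ = η * lam ^ b := mul_comm _ _

/-! ## The realisation theorems -/

/-- **Every Hölder weak Euler flow is realised by Leray–Hopf (indeed classical) Navier–Stokes
solutions with `W^{-1,∞}`-small forces, at every sufficiently small viscosity** (quantitative
form). For `T > 0`, `0 < β̄ ≤ 1`, a zero-mean weak Euler solution `u ∈ C^{β̄}([-2T,2T] × T³)`
(hypotheses as in `BuckmasterVicol2019_thm13`, through the shift `t ↦ u(t - 2T)`) and
`0 < β' < β̄/2`: there is `C ≥ 1` such that for every `η > 0` there is `ν₀ > 0` such that for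
every `0 < ν ≤ ν₀` some classical Navier–Stokes–Reynolds triple `(v, p, R)` at viscosity `ν` on
`[0,T] × T³` — i.e. a classical solution of Navier–Stokes with viscosity `ν` forced by the smooth
field `div R` — is a Leray–Hopf solution on `[0,T)` for that force with datum `v 0`, has zero mean,
`sup |R| ≤ η` on `[0,T] × T³`, `sup_t ‖v(t) - u(t)‖_{H^{β'}} ≤ η`, `sup_t ‖v(t)‖_{H^{β'}} ≤ C`, and
`sup_{t ∈ [0,T]} ‖v(t) - u(t)‖_{L²} ≤ η`. Proof: Buckmaster–Vicol's mollified start (2.12)–(2.15)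
at scale `λ = ν^{-1} ≥ max(Λ₀(η), (C/η)^{1/β̄})` (`BuckmasterVicol2019_mollifiedEulerStart_holds`),
read as a forced classical solution. [cite: BuckmasterVicol2019Annals, §2.5 (2.12)–(2.15)] -/
theorem holderEuler_lerayHopf_realisation_smallForce {T : ℝ} (hT : 0 < T) {βb : ℝ≥0}
    (hβb : 0 < βb) (hβb1 : βb ≤ 1) {u : ℝ → UnitAddTorus (Fin 3) → EuclideanSpace ℝ (Fin 3)}
    (hHolder : HolderOnSpaceTime βb (4 * T) (fun t => u (t - 2 * T)))
    (hEuler : Torus.IsWeakEulerSolutionOn (4 * T) (fun t => u (t - 2 * T)))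
    (hmean : ∀ t, Torus.HasZeroMean (u t)) {β' : ℝ} (hβ'0 : 0 < β') (hβ' : β' < βb / 2) :
    ∃ C : ℝ, 1 ≤ C ∧ ∀ η : ℝ, 0 < η → ∃ ν₀ : ℝ, 0 < ν₀ ∧ ∀ ν : ℝ, 0 < ν → ν ≤ ν₀ →
      ∃ (v : ℝ → UnitAddTorus (Fin 3) → EuclideanSpace ℝ (Fin 3)) (p : ℝ → UnitAddTorus (Fin 3) → ℝ)
        (R : ℝ → UnitAddTorus (Fin 3) → Fin 3 → EuclideanSpace ℝ (Fin 3)),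
        Torus.IsNSReynoldsOn (Icc 0 T) ν v p R ∧
        Torus.IsClassicalNSSolutionOn (Icc 0 T) ν (fun t x => Torus.tensorDivergence (R t) x) v p ∧
        Torus.IsLerayHopfOn T ν (fun t x => Torus.tensorDivergence (R t) x) (v 0) v ∧
        (∀ t ∈ Icc 0 T, Torus.HasZeroMean (v t)) ∧
        BDSV.SupLE T R η ∧
        (∀ t ∈ Icc 0 T, Torus.eSobolevNorm β' (EuclideanSpace.complexify ∘ (v t - u t)) ≤
          ENNReal.ofReal η) ∧
        (∀ t ∈ Icc 0 T, Torus.eSobolevNorm β' (EuclideanSpace.complexify ∘ v t) ≤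
          ENNReal.ofReal C) ∧
        (⨆ t ∈ Icc 0 T, eLpNorm (v t - u t) 2 volume) ≤ ENNReal.ofReal η := by
  obtain ⟨C, hC1, hC⟩ :=
    BuckmasterVicol2019_mollifiedEulerStart_holds T hT βb hβb hβb1 u hHolder hEuler hmean β' hβ'0 hβ'
  have hC0 : 0 ≤ C := zero_le_one.trans hC1
  have hβbR : (0 : ℝ) < βb := by exact_mod_cast hβb
  refine ⟨C, hC1, fun η hη => ?_⟩
  obtain ⟨Λ₀, hΛ₀, hΛ⟩ := hC η hη
  -- the scale threshold: `λ ≥ Λ₁` gives both `H^{β'}`-closeness `η` and `C λ^{-β̄} ≤ η`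
  set Λ₁ : ℝ := max Λ₀ ((C / η) ^ (1 / (βb : ℝ))) with hΛ₁_def
  have hΛ₁pos : 0 < Λ₁ := lt_of_lt_of_le one_pos (hΛ₀.trans (le_max_left _ _))
  refine ⟨Λ₁⁻¹, inv_pos.2 hΛ₁pos, fun ν hν0 hνle => ?_⟩
  -- mollify at scale `λ = ν⁻¹`
  set lam : ℝ := ν⁻¹ with hlam_def
  have hlamΛ₁ : Λ₁ ≤ lam := (le_inv_comm₀ hν0 hΛ₁pos).1 hνle
  have hlamΛ₀ : Λ₀ ≤ lam := (le_max_left _ _).trans hlamΛ₁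
  have hlam0 : 0 < lam := inv_pos.2 hν0
  have hνlam : ν ≤ lam⁻¹ := (inv_inv ν).symm.le
  obtain ⟨v, p, R, hNSR, hvmean, _hv0, _hv1, _hv2, hR0, _hR1, _hR2, hclose, hbound⟩ :=
    hΛ lam hlamΛ₀ ν hν0 hνlam
  have hclass := isClassicalNSSolutionOn_stressForce hNSR
  have hLH := isLerayHopfOn_stressForce hT hNSR
  -- `‖R‖_{C⁰} ≤ C λ^{-β̄} ≤ η`
  have hRη : BDSV.SupLE T R η :=
    hR0.mono (mul_rpow_neg_le_of_le hC0 hη hβbR hlam0 ((le_max_right _ _).trans hlamΛ₁))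
  -- `‖·‖_{L²} ≤ ‖·‖_{H^{β'}}`
  have hL2 : (⨆ t ∈ Icc 0 T, eLpNorm (v t - u t) 2 volume) ≤ ENNReal.ofReal η := by
    refine iSup₂_le fun t ht => ?_
    refine (eLpNorm_two_le_eSobolevNorm hβ'0.le ?_).trans (hclose t ht)
    rw [complexify_comp_sub]
    exact (integrable_complexify_comp
        (hNSR.smooth_velocity.isSmooth_slice ht).continuous.integrable_unitAddTorus).sub
      (integrable_complexify_comp
        (continuous_slice_of_holderOnSpaceTime_shift hβb hT hHolder ht).integrable_unitAddTorus)
  exact ⟨v, p, R, hNSR, hclass, hLH, hvmean, hRη, hclose, hbound, hL2⟩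

/-- **Realisation for all sufficiently small viscosities** (`∀ᶠ ν in 𝓝[>] 0`): the filter form of
`holderEuler_lerayHopf_realisation_smallForce`. [cite: BuckmasterVicol2019Annals, §2.5 (2.12)–(2.15)] -/
theorem holderEuler_lerayHopf_realisation_eventually {T : ℝ} (hT : 0 < T) {βb : ℝ≥0}
    (hβb : 0 < βb) (hβb1 : βb ≤ 1) {u : ℝ → UnitAddTorus (Fin 3) → EuclideanSpace ℝ (Fin 3)}
    (hHolder : HolderOnSpaceTime βb (4 * T) (fun t => u (t - 2 * T)))
    (hEuler : Torus.IsWeakEulerSolutionOn (4 * T) (fun t => u (t - 2 * T)))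
    (hmean : ∀ t, Torus.HasZeroMean (u t)) {β' : ℝ} (hβ'0 : 0 < β') (hβ' : β' < βb / 2) :
    ∃ C : ℝ, 1 ≤ C ∧ ∀ η : ℝ, 0 < η → ∀ᶠ ν in 𝓝[>] (0 : ℝ),
      ∃ (v : ℝ → UnitAddTorus (Fin 3) → EuclideanSpace ℝ (Fin 3)) (p : ℝ → UnitAddTorus (Fin 3) → ℝ)
        (R : ℝ → UnitAddTorus (Fin 3) → Fin 3 → EuclideanSpace ℝ (Fin 3)),
        Torus.IsNSReynoldsOn (Icc 0 T) ν v p R ∧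
        Torus.IsClassicalNSSolutionOn (Icc 0 T) ν (fun t x => Torus.tensorDivergence (R t) x) v p ∧
        Torus.IsLerayHopfOn T ν (fun t x => Torus.tensorDivergence (R t) x) (v 0) v ∧
        (∀ t ∈ Icc 0 T, Torus.HasZeroMean (v t)) ∧
        BDSV.SupLE T R η ∧
        (∀ t ∈ Icc 0 T, Torus.eSobolevNorm β' (EuclideanSpace.complexify ∘ (v t - u t)) ≤
          ENNReal.ofReal η) ∧
        (∀ t ∈ Icc 0 T, Torus.eSobolevNorm β' (EuclideanSpace.complexify ∘ v t) ≤
          ENNReal.ofReal C) ∧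
        (⨆ t ∈ Icc 0 T, eLpNorm (v t - u t) 2 volume) ≤ ENNReal.ofReal η := by
  obtain ⟨C, hC1, h⟩ :=
    holderEuler_lerayHopf_realisation_smallForce hT hβb hβb1 hHolder hEuler hmean hβ'0 hβ'
  refine ⟨C, hC1, fun η hη => ?_⟩
  obtain ⟨ν₀, hν₀, hν⟩ := h η hη
  filter_upwards [Ioc_mem_nhdsGT hν₀] with ν hν' using hν ν hν'.1 hν'.2

/-- **Realisation along any prescribed viscosities `ν_n → 0`** (`ν_n > 0`): for every accuracy
`η > 0`, eventually in `n` there is a classical, Leray–Hopf-on-`[0,T)` solution of Navier–Stokes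
with viscosity `ν_n` and force `div R`, `sup |R| ≤ η`, zero-mean, `η`-close to `u` in `C⁰_t H^{β'}_x`
and `C⁰_t L²_x`, with `sup_t ‖v(t)‖_{H^{β'}} ≤ C`. [cite: BuckmasterVicol2019Annals, §2.5 (2.12)–(2.15)] -/
theorem holderEuler_lerayHopf_realisation_eventually_seq {T : ℝ} (hT : 0 < T) {βb : ℝ≥0}
    (hβb : 0 < βb) (hβb1 : βb ≤ 1) {u : ℝ → UnitAddTorus (Fin 3) → EuclideanSpace ℝ (Fin 3)}
    (hHolder : HolderOnSpaceTime βb (4 * T) (fun t => u (t - 2 * T)))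
    (hEuler : Torus.IsWeakEulerSolutionOn (4 * T) (fun t => u (t - 2 * T)))
    (hmean : ∀ t, Torus.HasZeroMean (u t)) {β' : ℝ} (hβ'0 : 0 < β') (hβ' : β' < βb / 2)
    {ν : ℕ → ℝ} (hνpos : ∀ n, 0 < ν n) (hνlim : Tendsto ν atTop (𝓝 0)) :
    ∃ C : ℝ, 1 ≤ C ∧ ∀ η : ℝ, 0 < η → ∀ᶠ n in atTop,
      ∃ (v : ℝ → UnitAddTorus (Fin 3) → EuclideanSpace ℝ (Fin 3)) (p : ℝ → UnitAddTorus (Fin 3) → ℝ)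
        (R : ℝ → UnitAddTorus (Fin 3) → Fin 3 → EuclideanSpace ℝ (Fin 3)),
        Torus.IsNSReynoldsOn (Icc 0 T) (ν n) v p R ∧
        Torus.IsClassicalNSSolutionOn (Icc 0 T) (ν n)
          (fun t x => Torus.tensorDivergence (R t) x) v p ∧
        Torus.IsLerayHopfOn T (ν n) (fun t x => Torus.tensorDivergence (R t) x) (v 0) v ∧
        (∀ t ∈ Icc 0 T, Torus.HasZeroMean (v t)) ∧
        BDSV.SupLE T R η ∧
        (∀ t ∈ Icc 0 T, Torus.eSobolevNorm β' (EuclideanSpace.complexify ∘ (v t - u t)) ≤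
          ENNReal.ofReal η) ∧
        (∀ t ∈ Icc 0 T, Torus.eSobolevNorm β' (EuclideanSpace.complexify ∘ v t) ≤
          ENNReal.ofReal C) ∧
        (⨆ t ∈ Icc 0 T, eLpNorm (v t - u t) 2 volume) ≤ ENNReal.ofReal η := by
  obtain ⟨C, hC1, h⟩ :=
    holderEuler_lerayHopf_realisation_eventually hT hβb hβb1 hHolder hEuler hmean hβ'0 hβ'
  have hlim : Tendsto ν atTop (𝓝[>] (0 : ℝ)) :=
    tendsto_nhdsWithin_iff.2 ⟨hνlim, Eventually.of_forall hνpos⟩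
  exact ⟨C, hC1, fun η hη => hlim.eventually (h η hη)⟩

/-- **Buckmaster–Vicol 2019, Thm. 1.3, in the Leray–Hopf class modulo `W^{-1,∞}`-vanishing
forces.** For `β̄ > 0`, `T > 0` and a zero-mean weak Euler solution `u ∈ C^{β̄}([-2T,2T] × T³)`
(hypotheses literally those of `BuckmasterVicol2019_thm13`) there are `β > 0`, viscosities
`ν_n → 0` (`ν_n > 0`) and CLASSICAL solutions `(v_n, p_n)` of the Navier–Stokes equations with
viscosity `ν_n` on `[0,T] × T³`, driven by the smooth forces `f_n = div R_n` with `sup |R_n| ≤ 1/(n+1)`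
(`f_n → 0` in `C⁰_t W^{-1,∞}`), each a Leray–Hopf weak solution on `[0,T)` for its own force and
datum `v_n(0)`, zero-mean, uniformly bounded in `C⁰_t H^β_x`, with
`sup_t ‖v_n(t) - u(t)‖_{H^β} ≤ 1/(n+1)` and `v_n → u` strongly in `C⁰([0,T]; L²(T³))`. Compare the
vendored `BuckmasterVicol2019_thm13` (UNFORCED equations, WEAK solutions, by the full intermittent
scheme): in the Leray–Hopf class the same conclusion costs only the mollified start (2.12)–(2.15)
once the force `div R_n → 0` (in `W^{-1,∞}`, not in `L²`) is admitted — the realisation problem of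
the parent block is a problem about the force. [cite: BuckmasterVicol2019Annals, Thm. 1.3 and §2.5 (2.12)–(2.15)] -/
theorem BuckmasterVicol2019_thm13_lerayHopf_smallForce :
    ∀ (T : ℝ) (_hT : 0 < T) (βb : ℝ≥0) (_hβb : 0 < βb)
      (u : ℝ → UnitAddTorus (Fin 3) → EuclideanSpace ℝ (Fin 3))
      (_hHolder : HolderOnSpaceTime βb (4 * T) (fun t => u (t - 2 * T)))
      (_hEuler : Torus.IsWeakEulerSolutionOn (4 * T) (fun t => u (t - 2 * T)))
      (_hmean : ∀ t, Torus.HasZeroMean (u t)),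
    ∃ (β : ℝ) (ν : ℕ → ℝ) (v : ℕ → ℝ → UnitAddTorus (Fin 3) → EuclideanSpace ℝ (Fin 3))
      (p : ℕ → ℝ → UnitAddTorus (Fin 3) → ℝ)
      (R : ℕ → ℝ → UnitAddTorus (Fin 3) → Fin 3 → EuclideanSpace ℝ (Fin 3)),
      0 < β ∧ (∀ n, 0 < ν n) ∧ Tendsto ν atTop (𝓝 0) ∧
      (∀ n, Torus.IsNSReynoldsOn (Icc 0 T) (ν n) (v n) (p n) (R n)) ∧
      (∀ n, Torus.IsClassicalNSSolutionOn (Icc 0 T) (ν n)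
        (fun t x => Torus.tensorDivergence (R n t) x) (v n) (p n)) ∧
      (∀ n, Torus.IsLerayHopfOn T (ν n) (fun t x => Torus.tensorDivergence (R n t) x)
        (v n 0) (v n)) ∧
      (∀ n, ∀ t ∈ Icc 0 T, Torus.HasZeroMean (v n t)) ∧
      (∀ n, BDSV.SupLE T (R n) (1 / ((n : ℝ) + 1))) ∧
      (∃ M : ℝ≥0, ∀ n, ∀ t ∈ Icc 0 T,
        Torus.eSobolevNorm β (EuclideanSpace.complexify ∘ v n t) ≤ M) ∧
      (∀ n, ∀ t ∈ Icc 0 T,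
        Torus.eSobolevNorm β (EuclideanSpace.complexify ∘ (v n t - u t)) ≤
          ENNReal.ofReal (1 / ((n : ℝ) + 1))) ∧
      Tendsto (fun n => ⨆ t ∈ Icc 0 T, eLpNorm (v n t - u t) 2 volume) atTop (𝓝 0) := by
  intro T hT βbar hβbar u hHolder hEuler hmean
  -- lower the Hölder exponent to `β̄ ∧ 1`
  set βb : ℝ≥0 := min βbar 1 with hβb_def
  have hβb0 : 0 < βb := lt_min hβbar one_pos
  have hβb1 : βb ≤ 1 := min_le_right _ _
  have hHolder' : HolderOnSpaceTime βb (4 * T) (fun t => u (t - 2 * T)) :=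
    holderOnSpaceTime_of_le hHolder (min_le_left _ _)
  -- the Sobolev exponent `β = β̄/4 < β̄/2`
  set β : ℝ := (βb : ℝ) / 4 with hβ_def
  have hβ0 : 0 < β := by positivity
  have hβlt : β < βb / 2 := by rw [hβ_def]; linarith
  obtain ⟨C, hC1, h⟩ :=
    holderEuler_lerayHopf_realisation_smallForce hT hβb0 hβb1 hHolder' hEuler hmean hβ0 hβlt
  -- accuracy `1/(n+1)` at level `n`
  have hη : ∀ n : ℕ, (0 : ℝ) < 1 / ((n : ℝ) + 1) := fun n => by positivity
  choose ν₀ hν₀ hν using fun n : ℕ => h (1 / ((n : ℝ) + 1)) (hη n)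
  set ν : ℕ → ℝ := fun n => min (ν₀ n) (1 / ((n : ℝ) + 1)) with hν_def
  have hνpos : ∀ n, 0 < ν n := fun n => lt_min (hν₀ n) (hη n)
  choose v p R hNSR hclass hLH hvmean hR hclose hbound hL2 using
    fun n : ℕ => hν n (ν n) (hνpos n) (min_le_left _ _)
  refine ⟨β, ν, v, p, R, hβ0, hνpos, ?_, hNSR, hclass, hLH, hvmean, hR,
    ⟨C.toNNReal, fun n t ht => ?_⟩, hclose, ?_⟩
  · exact tendsto_of_tendsto_of_tendsto_of_le_of_le tendsto_const_nhds
      tendsto_one_div_add_atTop_nhds_zero_nat (fun n => (hνpos n).le) (fun n => min_le_right _ _)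
  · have hC' : ENNReal.ofReal C = ((C.toNNReal : ℝ≥0) : ℝ≥0∞) := rfl
    exact hC' ▸ hbound n t ht
  · refine tendsto_of_tendsto_of_tendsto_of_le_of_le tendsto_const_nhds ?_ (fun n => zero_le) hL2
    rw [← ENNReal.ofReal_zero]
    exact ENNReal.tendsto_ofReal tendsto_one_div_add_atTop_nhds_zero_nat

end Literature.Barriers.AnomalousDissipation

end
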